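import Literature.NumberTheory.Sieve.LinearEquationsInPrimes
import Literature.NumberTheory.Sieve.SieveFramework
import Summits.Parity.GeneralizedHardyLittlewood.Theorems.LeeYangFibresAbsoluteUpgradeSinglesDecaySeq
import Mathlib.Analysis.Convex.Basic
import HarnessLib

/-!
# Route `DicksonFibration`, crux `DimOne` (stmt-Parity-0819): vocabulary of the line `birth`
# (splitting `Λ = Λ♯ + Λ♭` along a `d = 1` system, sorted by the number of rough factors) —
# SIEVE-MODEL RESHAPE of the registered skeleton `Cruxes/DimOne/Lines/birth.lean`

Route-posited objects (D-0016 `<Route><Crux>Defs` file) shared by the registered stubs of the crux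
skeleton and by the stub files `Theorems/DicksonFibrationDimOne<Stub>.lean` that prove them. NOTHING IS
ASSERTED: every `def … : Prop` below is the *statement* of a registered stub (or of a composition proved
inside the skeleton); the only theorems are unfolding lemmas.

THE LINE (lead `prover-line-stmt-Parity-0819-c2-0`, 2026-08-17). The crux `DimOne` is Green–Tao's
Conj. 1.2 at `d = 1` (Dickson–Hardy–Littlewood with von Mangoldt weights, uniform in shifts `≤ LN`).
Write `Λ = Λ♯ + Λ♭` on `ℤ` with the SIEVE MODEL
`Λ♯_N(m) = 1[m > 0] · Λ_{ℤ/P}(m)`, `Λ_{ℤ/P}(m) = (P/φ(P)) · 1[(m, P) = 1]` (Green–Tao's local von Mangoldt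
function (1.5), tree `localVonMangoldt`) at the modulus `P = P_N = ∏_{p ≤ y_N} p`, `y_N = N^{1/u_N}`,
`u_N = ⌈√(log N)⌉` (`roughExp`, `roughLevel`, `sieveModulus`, `sharpZ`, `flatZ`). Expanding
`∏_i (Λ♭ + Λ♯)(ψ_i(n))` over the set `T` of positions carrying `Λ♭` gives
`vonMangoldtSum Ψ K N = Σ_T corrTerm T Ψ K N` and the terms are sorted by `#T`:

* `#T = 0`: `∏_i Λ♯(ψ_i n) = (P/φ(P))^t · 1[(ψ_i(n), P) = 1 ∀ i]` on the integer interval `I` of points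
  of `K` where every form is `≥ 1` (`IsPosInterval`), so `corrTerm ∅` is a SIFTED COUNT: the
  Fundamental Lemma of the `t`-dimensional sieve on the values of `F_Ψ = ∏ (a_k X + b_k)` gives
  `(P/φ(P))^t #{m ∈ I : (F_Ψ(m), P) = 1} = #I · ∏_{p ≤ y_N} β_p + o(N)` uniformly (`SieveCount`), and the
  uniform tail of the singular product in dimension one gives `∏_{p ≤ y_N} β_p = 𝔖(Ψ) + o(1)`
  (`SingularTailAtLevel`); with `|#I − β_∞| ≤ 1` this is the constant `archFactor · singularProduct`
  (`SharpMainTerm`, proved in the skeleton from the two stubs).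
* `#T = 1`: one `Λ` against `t − 1` sifting indicators: the Fundamental Lemma of dimension `t − 1` for the
  weights `Λ(ψ_i(m))`, whose level of distribution `N^{1/4}` is Bombieri–Vinogradov summed over the root
  classes of `∏_{k ≠ i} ψ_k` modulo square-free `d` (`PrimeClassSums` → `PrimeSieveMain`, i.e.
  `PrimeSieve`); the main terms of `#T = 0` and `#T = 1` agree EXACTLY (`(P/φ(P))^t V(z) = ∏_{p<z} β_p`),
  whence `corrTerm {i} = o(N)` (`OneFlatFactor`, proved in the skeleton).
* `#T ≥ 2`: `TwoFlatFactors` — the constant-free, parity-sensitive heart (at `t = 2`, `(n, n+2)`: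
  `Σ Λ♭(n)Λ♭(n+2) = Σ Λ(n)Λ(n+2) − 𝔖₂N + o(N)`), equivalent to the crux modulo the provable statements;
  every catalogued binary barrier (Selberg parity, Siegel zero, circle-method `L²`) bites here only.

References: B. Green, T. Tao, *Linear equations in primes*, Ann. of Math. 171 (2010), Conj. 1.2,
(1.5)–(1.7), Lemma 1.3, §12 (12.3) [GreenTao2010]; H. Halberstam, H.-E. Richert, *Sieve Methods* (1974),
Thm. 2.5, §5.7 [HalberstamRichert1974]; J. Friedlander, H. Iwaniec, *Opera de Cribro* (2010), Cor. 6.10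
[FriedlanderIwaniecOpera2010]; H. Iwaniec, E. Kowalski, *Analytic Number Theory* (2004), Thm. 17.1
[IwaniecKowalski2004].
-/

noncomputable section

open scoped BigOperators Classical
open Finset Literature.NumberTheory.Sieve
open Summit.Parity.GeneralizedHardyLittlewood.Theorems.AbsoluteUpgrade (rootsMod)

namespace Summit.Parity.GeneralizedHardyLittlewood.Cruxes.DimOne.BirthSieve

/-! ## The sieve model `Λ♯` and the mixed correlations -/

/-- The roughness exponent `u_N = ⌈√(log N)⌉` (so that `y_N = N^{1/u_N} = N^{o(1)}` and
`y_N ≥ exp(√(log N) − 1)` beats every power of `log N`). [folklore] -/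
def roughExp (N : ℕ) : ℕ :=
  ⌈Real.sqrt (Real.log N)⌉₊

/-- The sieve level `y_N = N^{1/u_N}` (junk `N^0 = 1` while `u_N = 0`, i.e. `N ≤ 1`). [folklore] -/
def roughLevel (N : ℕ) : ℝ :=
  (N : ℝ) ^ ((1 : ℝ) / (roughExp N : ℝ))

/-- The sieve modulus `P_N = ∏_{p ≤ y_N} p = primesProdBelow (⌊y_N⌋ + 1)` (square-free; its prime factors
are exactly the primes `≤ ⌊y_N⌋`, tree `dvd_primesProdBelow_iff`). [folklore] -/
def sieveModulus (N : ℕ) : ℕ :=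
  primesProdBelow (((⌊roughLevel N⌋₊ + 1 : ℕ) : ℝ))

/-- The sieve weight `P_N/φ(P_N) = ∏_{p ≤ y_N} p/(p − 1)` (the value of `Λ_{ℤ/P_N}` on the classes
coprime to `P_N`). [cite: GreenTao2010, (1.5)] -/
def sieveWeight (N : ℕ) : ℝ :=
  ((sieveModulus N : ℕ) : ℝ) / (Nat.totient (sieveModulus N) : ℝ)

/-- The SIEVE MODEL of the von Mangoldt function at scale `N`:
`Λ♯_N(m) = Λ_{ℤ/P_N}(m) = (P_N/φ(P_N)) · 1[(m, P_N) = 1]` for `m > 0` (Green–Tao's local von Mangoldt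
function (1.5), tree `localVonMangoldt`), and `0` for `m ≤ 0` (matching `intVonMangoldt` and the
positivity region of `archFactor`). [cite: GreenTao2010, (1.5) and §12 (12.3)] -/
def sharpZ (N : ℕ) (m : ℤ) : ℝ :=
  if 0 < m then localVonMangoldt (sieveModulus N) m else 0

/-- The rough piece `Λ♭_N := Λ − Λ♯_N` on `ℤ` (`intVonMangoldt m = Λ(m.toNat)`, zero for `m ≤ 0`).
[cite: GreenTao2010, §12 (12.3)] -/
def flatZ (N : ℕ) (m : ℤ) : ℝ :=
  intVonMangoldt m - sharpZ N m

/-- The mixed correlation `C_T = Σ_{n ∈ K ∩ [−N,N] ∩ ℤ} ∏_{i ∈ T} Λ♭_N(ψ_i(n)) · ∏_{i ∉ T} Λ♯_N(ψ_i(n))`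
(rough factors on `T`, sieve-model factors off `T`; the crux's own range of summation, verbatim).
[cite: GreenTao2010, (1.2) and (12.3)] -/
def corrTerm {t : ℕ} (T : Finset (Fin t)) (Ψ : Fin t → AffLinForm 1) (K : Set (Fin 1 → ℝ))
    (N : ℕ) : ℝ :=
  ∑ n ∈ (latticeBox 1 N).filter (fun n => realPoint n ∈ K),
    (∏ i ∈ T, flatZ N ((Ψ i).eval n)) * ∏ i ∈ univ \ T, sharpZ N ((Ψ i).eval n)

/-- `IsPosInterval Ψ N m₁ m₂`: the integer interval `[m₁, m₂]` lies in `[−N, N]` and every form of `Ψ`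
is `≥ 1` on it (the lattice points of `K ∩ {all ψ_k > 0}` for a convex `K ⊆ [−N, N]` form such an
interval, tree `DimOne.exists_filter_eq_Icc`). [folklore] -/
def IsPosInterval {t : ℕ} (Ψ : Fin t → AffLinForm 1) (N : ℕ) (m₁ m₂ : ℤ) : Prop :=
  ∀ m ∈ Finset.Icc m₁ m₂, m ∈ Finset.Icc (-(N : ℤ)) N ∧ ∀ k, 1 ≤ (Ψ k).eval (fun _ => m)

/-! ## Unfolding lemmas -/

/-- `Λ♯_N(m) = 0` for `m ≤ 0`. [folklore] -/
theorem sharpZ_of_nonpos (N : ℕ) {m : ℤ} (hm : m ≤ 0) : sharpZ N m = 0 := by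
  unfold sharpZ
  rw [if_neg (not_lt.mpr hm)]

/-- `Λ♯_N(m) = P_N/φ(P_N)` if `m > 0` and `(m, P_N) = 1`, and `0` otherwise. [cite: GreenTao2010, (1.5)] -/
theorem sharpZ_eq (N : ℕ) (m : ℤ) :
    sharpZ N m = if 0 < m ∧ Int.gcd m (sieveModulus N) = 1 then sieveWeight N else 0 := by
  unfold sharpZ localVonMangoldt sieveWeight
  by_cases h0 : 0 < m
  · by_cases h1 : Int.gcd m (sieveModulus N) = 1
    · rw [if_pos h0, if_pos h1, if_pos ⟨h0, h1⟩]
    · rw [if_pos h0, if_neg h1, if_neg (fun h => h1 h.2)]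
  · rw [if_neg h0, if_neg (fun h => h0 h.1)]

/-- `Λ♭_N(m) = 0` for `m ≤ 0`. [folklore] -/
theorem flatZ_of_nonpos (N : ℕ) {m : ℤ} (hm : m ≤ 0) : flatZ N m = 0 := by
  unfold flatZ intVonMangoldt
  rw [sharpZ_of_nonpos N hm, Int.toNat_of_nonpos hm, ArithmeticFunction.map_zero, sub_zero]

/-- `Λ = Λ♭_N + Λ♯_N` on `ℤ`, pointwise (definitional). [cite: GreenTao2010, §12 (12.3)] -/
theorem intVonMangoldt_eq_flatZ_add_sharpZ (N : ℕ) (m : ℤ) :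
    intVonMangoldt m = flatZ N m + sharpZ N m := by
  unfold flatZ
  ring

/-- The splitting `Λ = Λ♭_N + Λ♯_N` on `ℤ` (registered sanity sub-goal `flatZ_add_sharpZ` of
stmt-Parity-0819, carried by this vocabulary file). [cite: GreenTao2010, §12 (12.3)] -/
theorem flatZ_add_sharpZ : ∀ (N : ℕ) (m : ℤ), flatZ N m + sharpZ N m = Literature.NumberTheory.Sieve.intVonMangoldt m := by
  intro N m
  rw [intVonMangoldt_eq_flatZ_add_sharpZ N m]

/-! ## Statements of the registered stubs (NOTHING is asserted here) -/

/-- **S♯-count (`stub_sieveCount`) — the Fundamental Lemma for the values of a one-dimensional system.**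
Uniformly over non-degenerate `Ψ` of `t` forms with `‖Ψ‖_N ≤ L` and integer intervals `I = [m₁, m₂] ⊆
[−N, N]` on which every form is `≥ 1`:
`|(P_N/φ(P_N))^t · #{m ∈ I : (ψ_k(m), P_N) = 1 ∀ k} − #I · ∏_{p ≤ ⌊y_N⌋} β_p(Ψ)| ≤ ε N` for `N ≥ N₀(t, L, ε)`.
(Two-sided Fundamental Lemma, dimension `2(L + t)`, level `D = N^{1/4}`, `s = log D/log z ≍ √(log N)`, on
the tree's `AbsoluteUpgrade.valSeq (sysPoly Ψ) I #I`; main term `(P/φ(P))^t · #I · V(z) = #I ∏_{p<z} β_p`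
by `AbsoluteUpgrade.prod_one_sub_rootCount_eq`; remainders `|R_d| ≤ ω_F(d) ≤ d`; a local obstruction
makes both sides vanish.) -/
def SieveCount : Prop :=
  ∀ (t L : ℕ), ∀ ε : ℝ, 0 < ε → ∃ N₀ : ℕ, ∀ N : ℕ, N₀ ≤ N →
    ∀ Ψ : Fin t → AffLinForm 1, IsNondegenerateSystem Ψ → affLinSize Ψ N ≤ L →
      ∀ m₁ m₂ : ℤ, IsPosInterval Ψ N m₁ m₂ →
        |sieveWeight N ^ t *
              (#((Finset.Icc m₁ m₂).filter (fun m : ℤ =>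
                  ∀ k, Int.gcd ((Ψ k).eval (fun _ => m)) (sieveModulus N) = 1)) : ℝ) -
            (#(Finset.Icc m₁ m₂) : ℝ) * singularProductPartial Ψ ⌊roughLevel N⌋₊| ≤ ε * N

/-- **Singular tail at the sieve level (`stub_singularTail`).** Uniformly over non-degenerate `Ψ` of `t`
forms with `‖Ψ‖_N ≤ L`: `|∏_{p ≤ ⌊y_N⌋} β_p(Ψ) − 𝔖(Ψ)| ≤ ε` and `∏_{p ≤ ⌊y_N⌋} β_p(Ψ) ≤ ε N` for
`N ≥ N₀(t, L, ε)`. (Generic primes `p > y` have `|β_p − 1| ≤ T²/p²`; the `≤ t² log(2L²N)/log y` primes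
dividing a cross-discriminant `a_i b_k − a_k b_i` have `|β_p − 1| ≤ 4t/p`; the head is `≤ (C log y)^t` by
Mertens; tree template `TranslateAmplification.stub_singularTail`, `sum_abs_localFactor_sub_one_le`.) -/
def SingularTailAtLevel : Prop :=
  ∀ (t L : ℕ), ∀ ε : ℝ, 0 < ε → ∃ N₀ : ℕ, ∀ N : ℕ, N₀ ≤ N →
    ∀ Ψ : Fin t → AffLinForm 1, IsNondegenerateSystem Ψ → affLinSize Ψ N ≤ L →
      |singularProductPartial Ψ ⌊roughLevel N⌋₊ - singularProduct Ψ| ≤ ε ∧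
        singularProductPartial Ψ ⌊roughLevel N⌋₊ ≤ ε * N

/-- **Class sums of `Λ` along a form, averaged over square-free moduli with root-count weights
(`stub_primeClassSums`) — Bombieri–Vinogradov.** For `B, A` there are `C, x₀` such that for `x ≥ x₀`,
every `F ∈ ℤ[X]` with `ω_F(p) ≤ B` at all primes, every form `a m + b` (`a ≠ 0`, `gcd(a, b) = 1`) which is
`≥ 1` and `≤ x` on the integer interval `[m₁, m₂]`, and every `D` with `|a| D ≤ x^{1/4}`:
`Σ_{d ≤ D squarefree} Σ_{s mod d : d ∣ F(s), (a s + b, d) = 1}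
   |Σ_{m ∈ [m₁, m₂], m ≡ s (d)} Λ(a m + b) − |a| · #[m₁, m₂] / φ(|a| d)| ≤ C x/(log x)^A`
(the inner sum is `ψ` over the class `a s + b (mod |a| d)` in one value interval of length `|a| · #[m₁,m₂]`;
worst class per modulus, `ω_F(d) ≤ B^{ω(d)}`, Cauchy–Schwarz, and the tree's PROVED
`BombieriVinogradovStatement_holds` / `primesHaveLevel_half` at moduli `|a| d ≤ x^{1/4}`; Liouville
template `AbsoluteUpgrade.classSums_le`). -/
def PrimeClassSums : Prop :=
  ∀ (B A : ℕ), ∃ C x₀ : ℝ, ∀ x : ℝ, x₀ ≤ x →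
    ∀ F : Polynomial ℤ, (∀ p : ℕ, p.Prime → polyRootCountMod ![F] p ≤ B) →
      ∀ (a b m₁ m₂ : ℤ), a ≠ 0 → IsCoprime a b → m₁ ≤ m₂ →
        (∀ m ∈ Finset.Icc m₁ m₂, 1 ≤ a * m + b) →
          (∀ m ∈ Finset.Icc m₁ m₂, ((a * m + b : ℤ) : ℝ) ≤ x) →
            ∀ D : ℕ, ((a.natAbs * D : ℕ) : ℝ) ≤ x ^ (1 / 4 : ℝ) →
              ∑ d ∈ (Finset.Icc 1 D).filter Squarefree,
                ∑ s ∈ (rootsMod F d).filter (fun s : ℕ => Int.gcd (a * s + b) d = 1),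
                  |∑ m ∈ (Finset.Icc m₁ m₂).filter (fun m : ℤ => m ≡ (s : ℤ) [ZMOD d]),
                      intVonMangoldt (a * m + b) -
                    (a.natAbs : ℝ) * (#(Finset.Icc m₁ m₂) : ℝ) / (Nat.totient (a.natAbs * d) : ℝ)|
                ≤ C * x / Real.log x ^ A

/-- **One prime among sifted forms (conclusion of `stub_primeSieve`).** Uniformly over non-degenerate
`Ψ` of `t` forms with `‖Ψ‖_N ≤ L`, `i`, and integer intervals `I = [m₁, m₂] ⊆ [−N, N]` on which every form
is `≥ 1`: `|(P_N/φ(P_N))^{t−1} Σ_{m ∈ I : (ψ_k(m), P_N) = 1 ∀ k ≠ i} Λ(ψ_i(m)) − #I · ∏_{p ≤ ⌊y_N⌋} β_p(Ψ)| ≤ ε N`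
for `N ≥ N₀(t, L, ε)`. (Fundamental Lemma of dimension `t − 1` for the weights `Λ(ψ_i(m))` on the values
of `∏_{k ≠ i} ψ_k`, density `g_i(p) = #{s : p ∣ ∏_{k≠i} ψ_k(s), p ∤ ψ_i(s)}/(p − 1)` (`p ∤ a_i`) resp. `…/p`
(`p ∣ a_i`), level `N^{1/4}` from `PrimeClassSums`; local identity
`(P/φ(P))^{t−1} (|a_i|/φ(|a_i|)) ∏_{p<z} (1 − g_i(p)) = ∏_{p<z} β_p`; `gcd(a_i, b_i) > 1` and local
obstructions make both sides `o(N)`.) -/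
def PrimeSieveMain : Prop :=
  ∀ (t L : ℕ), ∀ ε : ℝ, 0 < ε → ∃ N₀ : ℕ, ∀ N : ℕ, N₀ ≤ N →
    ∀ Ψ : Fin t → AffLinForm 1, IsNondegenerateSystem Ψ → affLinSize Ψ N ≤ L → ∀ i : Fin t,
      ∀ m₁ m₂ : ℤ, IsPosInterval Ψ N m₁ m₂ →
        |sieveWeight N ^ (t - 1) *
              (∑ m ∈ (Finset.Icc m₁ m₂).filter (fun m : ℤ =>
                  ∀ k, k ≠ i → Int.gcd ((Ψ k).eval (fun _ => m)) (sieveModulus N) = 1),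
                intVonMangoldt ((Ψ i).eval (fun _ => m))) -
            (#(Finset.Icc m₁ m₂) : ℝ) * singularProductPartial Ψ ⌊roughLevel N⌋₊| ≤ ε * N

/-- **`stub_primeSieve`**: the Bombieri–Vinogradov class sums imply the one-prime sifted sum. -/
def PrimeSieve : Prop :=
  PrimeClassSums → PrimeSieveMain

/-- **S2 — AT LEAST TWO ROUGH FACTORS (`stub_twoFlatFactors`; the load-bearing, open, parity-sensitive
statement):** `|Σ_{T ⊆ [t], #T ≥ 2} C_T| ≤ ε N` uniformly. At `t = 2`, `Ψ = (n, n+2)`: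
`Σ Λ♭(n)Λ♭(n+2) = o(N)`, the twin-prime asymptotic in rough-vs-rough form (given `SharpMainTerm` and
`OneFlatFactor` it is EQUIVALENT to the crux). -/
def TwoFlatFactors : Prop :=
  ∀ (t L : ℕ), 1 ≤ t → ∀ ε : ℝ, 0 < ε → ∃ N₀ : ℕ, ∀ N : ℕ, N₀ ≤ N →
    ∀ Ψ : Fin t → AffLinForm 1, IsNondegenerateSystem Ψ → affLinSize Ψ N ≤ L →
      ∀ K : Set (Fin 1 → ℝ), Convex ℝ K → K ⊆ realBox 1 N →
        |∑ T ∈ (univ : Finset (Fin t)).powerset.filter (fun T => 2 ≤ T.card), corrTerm T Ψ K N|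
          ≤ ε * (N : ℝ)

/-! ## Statements of the two compositions proved inside the skeleton (not stubs) -/

/-- **S♯ — the sharp main term** (`SieveCount ∧ SingularTailAtLevel ⊢`): uniformly,
`|C_∅ − archFactor Ψ K · singularProduct Ψ| ≤ ε N`. Constant-bearing, parity-free. -/
def SharpMainTerm : Prop :=
  ∀ (t L : ℕ), 1 ≤ t → ∀ ε : ℝ, 0 < ε → ∃ N₀ : ℕ, ∀ N : ℕ, N₀ ≤ N →
    ∀ Ψ : Fin t → AffLinForm 1, IsNondegenerateSystem Ψ → affLinSize Ψ N ≤ L →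
      ∀ K : Set (Fin 1 → ℝ), Convex ℝ K → K ⊆ realBox 1 N →
        |corrTerm ∅ Ψ K N - archFactor Ψ K * singularProduct Ψ| ≤ ε * (N : ℝ)

/-- **S1 — one rough factor** (`SieveCount ∧ PrimeSieveMain ⊢`): uniformly, for every `i`,
`|C_{{i}}| ≤ ε N`. -/
def OneFlatFactor : Prop :=
  ∀ (t L : ℕ), 1 ≤ t → ∀ ε : ℝ, 0 < ε → ∃ N₀ : ℕ, ∀ N : ℕ, N₀ ≤ N →
    ∀ Ψ : Fin t → AffLinForm 1, IsNondegenerateSystem Ψ → affLinSize Ψ N ≤ L →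
      ∀ K : Set (Fin 1 → ℝ), Convex ℝ K → K ⊆ realBox 1 N →
        ∀ i : Fin t, |corrTerm {i} Ψ K N| ≤ ε * (N : ℝ)

/-! ## The open core of S2 (registered stub after the perimeter peel, lead c3, 2026-08-17) -/

/-- **S2 ON ITS OPEN CORE (`stub_twoFlatFactorsCore`)**: `TwoFlatFactors` restricted to `t ≥ 2` forms and to
systems WITHOUT LOCAL OBSTRUCTION — `β_p(Ψ) > 0` at every prime `p` (equivalently `𝔖(Ψ) > 0`, tree
`singularProduct_pos_of_localFactor_pos` / `singularProduct_eq_zero_of_localFactor_eq_zero`), i.e. every form is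
primitive and for each prime `p ≤ t` the forms do not cover all residues mod `p`. This is the admissible
Dickson–Hardy–Littlewood prime `t`-tuple conjecture with von Mangoldt weights, uniform in the shifts `≤ LN`, in
rough-vs-rough form; the complement (`t ≤ 1`, or some `β_p(Ψ) = 0`) is a theorem
(`…DimOnePerimeter.lean`: `sum_twoFlat_eq_zero`, `twoFlatFactors_of_localFactor_eq_zero`), and
`TwoFlatFactorsCore → TwoFlatFactors ↔ DimOne` (`twoFlatFactors_of_core'`, `twoFlatFactors_iff_dimOne`). Open for
every `t ≥ 2` (twin primes `(n, n + 2)`, Sophie Germain `(n, 2n + 1)`, Goldbach `(n, M − n)` uniformly in `M ≤ LN`);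
like every `def … : Prop` of this file it is the STATEMENT of a registered stub, nothing is asserted. -/
def TwoFlatFactorsCore : Prop :=
  ∀ (t L : ℕ), 2 ≤ t → ∀ ε : ℝ, 0 < ε → ∃ N₀ : ℕ, ∀ N : ℕ, N₀ ≤ N →
    ∀ Ψ : Fin t → AffLinForm 1, IsNondegenerateSystem Ψ → affLinSize Ψ N ≤ L →
      (∀ p : ℕ, p.Prime → 0 < localFactor Ψ p) →
        ∀ K : Set (Fin 1 → ℝ), Convex ℝ K → K ⊆ realBox 1 N →
          |∑ T ∈ (univ : Finset (Fin t)).powerset.filter (fun T => 2 ≤ T.card), corrTerm T Ψ K N|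
            ≤ ε * (N : ℝ)

/-- Unfolding `TwoFlatFactorsCore` — the form in which `twoFlatFactors_of_core'` (`…DimOnePerimeter.lean`)
consumes it (registered sanity sub-goal `twoFlatFactorsCore_iff` of stmt-Parity-0819, carried by this vocabulary
file). [folklore] -/
theorem twoFlatFactorsCore_iff : TwoFlatFactorsCore ↔ (∀ (t L : ℕ), 2 ≤ t → ∀ ε : ℝ, 0 < ε → ∃ N₀ : ℕ, ∀ N : ℕ, N₀ ≤ N → ∀ Ψ : Fin t → AffLinForm 1, IsNondegenerateSystem Ψ → affLinSize Ψ N ≤ L → (∀ p : ℕ, p.Prime → 0 < localFactor Ψ p) → ∀ K : Set (Fin 1 → ℝ), Convex ℝ K → K ⊆ realBox 1 N → |∑ T ∈ (univ : Finset (Fin t)).powerset.filter (fun T => 2 ≤ T.card), corrTerm T Ψ K N| ≤ ε * (N : ℝ)) :=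
  Iff.rfl

end Summit.Parity.GeneralizedHardyLittlewood.Cruxes.DimOne.BirthSieve

end
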